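import Summits.Parity.GeneralizedHardyLittlewood.Theorems.GreenTaoLevelTwoMNTwoAlmostLinearClass

/-!
# Route `GreenTaoLevelTwo`, crux `MNTwo` (stmt-Parity-21276), line `birth`, stub `stub_mnVertical`:
# Möbius vs. almost linear phases, THREE-TERM form — one residue class (GT 2008b Prop. 15)

Block V2/V6 of the `stub_mnVertical` census (B. Green, T. Tao, *Quadratic uniformity of the
Möbius function*, Ann. Inst. Fourier 58 (2008) = arXiv:math/0606087, §6, proof of Prop. 15).  This is
the variant of `…MNTwoAlmostLinearClass.norm_sum_class_le` in which the approximate-linearity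
hypothesis on a region `S` is replaced by exactly what the proof consumes, the THREE-TERM bound
"`φ(x) = φ(x+h₁+h₂) − φ(n_s+h₁) − φ(n_s+h₂) + 2φ(n_s) + O_{ℝ/ℤ}(ε)`" for `x, n_s` in the support of
`ψ`, congruent mod `q`, and shifts `h₁, h₂ ∈ H`.  This is the form needed in §12, where the shifts
are `H = q·B_g(0, ε/q)` and the three-term bound follows from the major-arc estimate
`‖qφ''(h,h')‖ ≲ ‖h‖_g‖h'‖_g` by local bilinearity in the `H`-slot only (the printed step "for
`q ∣ h, h'`" does not follow from bilinearity).  Proof = that of `norm_sum_class_le` verbatim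
(balanced-lift transfer to `ℤ/pℤ`, `…MNTwoApproxLinear`, `…MNTwoDualApproximation`, Davenport).
Def-free.

* `norm_sum_class_le_of_three_term` — one residue class:
  `‖Σ_{N<n≤2N, n≡r (q)} μ(n)ψ(n)e(−φ(n))‖ ≤ Σ_{class} (2πεψ + w) + √(p/#H) · D`.

References: [GreenTao2008QuadraticMobius] arXiv:math/0606087 §6, proof of Proposition 15.
-/

noncomputable section

open Finset Real ArithmeticFunction
open scoped ArithmeticFunction.Moebius

namespace Summit.Parity.GeneralizedHardyLittlewood.GreenTaoLevelTwoMNTwoAlmostLinearThreeTerm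

open Summit.Parity.GeneralizedHardyLittlewood.GreenTaoLevelTwoMNTwoDualApproximation
  (norm_sum_le_of_approx_dual)
open Summit.Parity.GeneralizedHardyLittlewood.GreenTaoLevelTwoMNTwoApproxLinear
  (norm_weight_phase_sub_le)
open Summit.Parity.GeneralizedHardyLittlewood.GreenTaoLevelTwoMNTwoMoebiusTransfer
  (sum_fiber_eq_sum norm_sum_moebius_block_progression_le)
open Summit.Parity.GeneralizedHardyLittlewood.GreenTaoLevelTwoMNTwoAlmostLinearClass
  (valMinAbs_eq_of_two_mul_abs_lt two_mul_abs_valMinAbs_le valMinAbs_intCast_of_two_mul_abs_lt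
   valMinAbs_add_intCast le_of_valMinAbs_add_ne sum_fiber_eq_sum_real)

/-! ### §2 One residue class, read in `ℤ/pℤ` -/

/-- **One residue class of GT 2008b Prop. 15, three-term form (explicit data).**  `N ≥ 1`,
`p ≥ 10N`, a residue `r` mod `q`; admissible shifts `H ∋ 0` with `|h| ≤ N`, `q ∣ h`; `0 ≤ ψ ≤ 1`
supported in `(N,2N]` with shift bound `|ψ(n+h₁+h₂) − ψ(n)| ≤ w(n)`; the THREE-TERM bound
`‖φ(n) − φ(n+h₁+h₂) + φ(nₛ+h₁) + φ(nₛ+h₂) − 2φ(nₛ)‖ ≤ ε` for `n ≡ nₛ (q)` in `supp ψ` and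
`h₁, h₂ ∈ H`; `D` a bound for the `ℤ/pℤ`-Fourier coefficients of `μ` on the class.  Then
`‖Σ_{N<n≤2N, n≡r} μψe(−φ)‖ ≤ Σ_{class}(2πεψ + w) + √(p/#H)·D`.
[cite: GreenTao2008QuadraticMobius, proof of Proposition 15] -/
theorem norm_sum_class_le_of_three_term {N : ℕ} (hN : 1 ≤ N) (p : ℕ) [NeZero p] (hp : 10 * N ≤ p)
    (q : ℕ) (r : ℕ) (H : Finset ℤ) (h0H : (0 : ℤ) ∈ H)
    (hH : ∀ h ∈ H, |h| ≤ N ∧ (q : ℤ) ∣ h)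
    (ψ w : ℤ → ℝ) (φ : ℤ → UnitAddCircle) {ε : ℝ} (hε : 0 ≤ ε)
    (hψ0 : ∀ n, 0 ≤ ψ n) (hψ1 : ∀ n, ψ n ≤ 1) (hsupp : ∀ n, ψ n ≠ 0 → (N : ℤ) < n ∧ n ≤ 2 * N)
    (hw0 : ∀ n, 0 ≤ w n) (hw : ∀ n, ∀ h₁ ∈ H, ∀ h₂ ∈ H, |ψ (n + h₁ + h₂) - ψ n| ≤ w n)
    (h3 : ∀ n nₛ : ℤ, ψ n ≠ 0 → ψ nₛ ≠ 0 → (q : ℤ) ∣ n - nₛ → ∀ h₁ ∈ H, ∀ h₂ ∈ H,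
      ‖φ n - φ (n + h₁ + h₂) + φ (nₛ + h₁) + φ (nₛ + h₂) - 2 • φ nₛ‖ ≤ ε)
    {D : ℝ} (hD0 : 0 ≤ D)
    (hD : ∀ ξ : ZMod p, ‖∑ n ∈ (Ioc N (2 * N)).filter (fun n : ℕ => n % q = r),
      ((μ n : ℝ) : ℂ) * (ZMod.stdAddChar ((n : ZMod p) * ξ) : ℂ)‖ ≤ D) :
    ‖∑ n ∈ (Ioc N (2 * N)).filter (fun n : ℕ => n % q = r),
        ((μ n : ℝ) : ℂ) * ((ψ n : ℝ) : ℂ) * ((AddCircle.toCircle (-φ n) : Circle) : ℂ)‖ ≤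
      (∑ n ∈ (Ioc N (2 * N)).filter (fun n : ℕ => n % q = r), (2 * Real.pi * ε * ψ n + w n)) +
        Real.sqrt (p / #H) * D := by
  classical
  set Sr := (Ioc N (2 * N)).filter (fun n : ℕ => n % q = r) with hSr
  have hpZ : (10 * N : ℤ) ≤ p := by exact_mod_cast hp
  have hmemSr : ∀ n ∈ Sr, N < n ∧ n ≤ 2 * N ∧ n % q = r := by
    intro n hn
    rw [hSr, mem_filter, mem_Ioc] at hn
    exact ⟨hn.1.1, hn.1.2, hn.2⟩
  -- the class residue as a divisibility in `ℤ`
  have hdvd_of_mod : ∀ n : ℕ, n % q = r → (q : ℤ) ∣ (n : ℤ) - r := by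
    intro n hn
    refine ⟨(n / q : ℕ), ?_⟩
    have := Nat.div_add_mod n q
    rw [hn] at this
    have e : (n : ℤ) = q * (n / q : ℕ) + r := by exact_mod_cast this.symm
    rw [e]; ring
  -- trivial case: `ψ` vanishes on the class
  by_cases hne : ∃ n ∈ Sr, ψ n ≠ 0
  swap
  · push Not at hne
    have e0 : ∑ n ∈ Sr, ((μ n : ℝ) : ℂ) * ((ψ n : ℝ) : ℂ) * ((AddCircle.toCircle (-φ n) : Circle) : ℂ) = 0 :=
      Finset.sum_eq_zero fun n hn => by rw [hne n hn]; simp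
    rw [e0, norm_zero]
    have h1 : 0 ≤ ∑ n ∈ Sr, (2 * Real.pi * ε * ψ n + w n) :=
      Finset.sum_nonneg fun n hn => by rw [hne n hn]; simpa using hw0 n
    have h2 : 0 ≤ Real.sqrt (p / #H) * D := mul_nonneg (Real.sqrt_nonneg _) hD0
    linarith
  obtain ⟨ns, hnsSr, hψns⟩ := hne
  obtain ⟨hns1, hns2, hnsr⟩ := hmemSr ns hnsSr
  -- the transferred data on `ℤ/pℤ`
  set ψ' : ZMod p → ℝ := fun x => if (q : ℤ) ∣ ZMod.valMinAbs x - r then ψ (ZMod.valMinAbs x) else 0 with hψ'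
  set φ' : ZMod p → UnitAddCircle := fun x => φ (ZMod.valMinAbs x) with hφ'
  set κ' : ZMod p → ℝ := fun x => w (ZMod.valMinAbs x) with hκ'
  set a : ZMod p → ℂ := fun x => ∑ n ∈ Sr.filter (fun n : ℕ => ((n : ℕ) : ZMod p) = x), ((μ n : ℝ) : ℂ)
    with ha
  set f : ZMod p → ℂ := fun y => (ψ' y : ℂ) * ((AddCircle.toCircle (-φ' y) : Circle) : ℂ) with hf
  set nₛ : ZMod p := ((ns : ℤ) : ZMod p) with hnₛ
  set F : ZMod p → ℂ := fun h => ((AddCircle.toCircle (φ' (nₛ + h)) : Circle) : ℂ) with hF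
  set c : ℂ := ((AddCircle.toCircle (-(2 • φ' nₛ)) : Circle) : ℂ) with hc
  set H' : Finset (ZMod p) := H.image (fun h : ℤ => (h : ZMod p)) with hH'
  set w' : ZMod p → ℝ := fun x =>
    ∑ n ∈ Sr.filter (fun n : ℕ => ((n : ℕ) : ZMod p) = x), (2 * Real.pi * ε * ψ n + w n) with hw'
  -- balanced lifts of the relevant small integers
  have hιint : ∀ m : ℤ, |m| ≤ 4 * N → ZMod.valMinAbs (m : ZMod p) = m := by
    intro m hm
    exact valMinAbs_intCast_of_two_mul_abs_lt (by linarith)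
  have hιnat : ∀ n : ℕ, n ≤ 2 * N → ZMod.valMinAbs ((n : ℕ) : ZMod p) = n := by
    intro n hn
    have e : ((n : ℕ) : ZMod p) = ((n : ℤ) : ZMod p) := by push_cast; rfl
    rw [e]
    apply hιint
    rw [abs_of_nonneg (by positivity)]
    exact_mod_cast (by omega : n ≤ 4 * N)
  have hιx : ∀ x : ZMod p, ((ZMod.valMinAbs x : ℤ) : ZMod p) = x := fun x => ZMod.coe_valMinAbs x
  have hιabs : ∀ x : ZMod p, 2 * |ZMod.valMinAbs x| ≤ (p : ℤ) := fun x => two_mul_abs_valMinAbs_le x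
  have hιns : ZMod.valMinAbs nₛ = ns := by
    rw [hnₛ]; apply hιint; rw [abs_of_nonneg (by positivity)]; exact_mod_cast (by omega : ns ≤ 4 * N)
  have hmemH' : ∀ h' ∈ H', ∃ h ∈ H, (h : ZMod p) = h' := fun h' hh' => by
    simpa [hH', mem_image] using hh'
  -- elements of `supp ψ` shifted twice by `H` stay within `|·| ≤ 4N`
  have hshift : ∀ n : ℤ, (N : ℤ) < n ∧ n ≤ 2 * N → ∀ h₁ ∈ H, ∀ h₂ ∈ H, |n + h₁ + h₂| ≤ 4 * N := by
    intro n hn h₁ hh₁ h₂ hh₂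
    have := (hH h₁ hh₁).1; have := (hH h₂ hh₂).1
    rw [abs_le] at *
    constructor <;> linarith
  have hψ'0 : ∀ x, 0 ≤ ψ' x := fun x => by
    simp only [hψ']; split_ifs
    · exact hψ0 _
    · exact le_rfl
  have hψ'1 : ∀ x, ψ' x ≤ 1 := fun x => by
    simp only [hψ']; split_ifs
    · exact hψ1 _
    · exact zero_le_one
  have hfle : ∀ y, ‖f y‖ ≤ 1 := fun y => by
    simp only [hf]
    rw [norm_mul, Circle.norm_coe, mul_one, Complex.norm_real, Real.norm_eq_abs,
      abs_of_nonneg (hψ'0 y)]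
    exact hψ'1 y
  have hFle : ∀ h ∈ H', ‖F h‖ ≤ 1 := fun h _ => by simp only [hF]; rw [Circle.norm_coe]
  have hDa : ∀ ξ : ZMod p, ‖∑ x : ZMod p, a x * (ZMod.stdAddChar (x * ξ) : ℂ)‖ ≤ D := by
    intro ξ
    simp only [ha]
    rw [sum_fiber_eq_sum Sr (fun n => ((μ n : ℝ) : ℂ)) (fun x => (ZMod.stdAddChar (x * ξ) : ℂ))]
    exact hD ξ
  have hH'ne : H'.Nonempty := ⟨((0 : ℤ) : ZMod p), mem_image.2 ⟨0, h0H, rfl⟩⟩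
  have hcardH' : #H' = #H := by
    rw [hH']
    refine Finset.card_image_of_injOn fun h₁ hh₁ h₂ hh₂ heq => ?_
    have e1 := hιint h₁ (by have := (hH h₁ hh₁).1; linarith)
    have e2 := hιint h₂ (by have := (hH h₂ hh₂).1; linarith)
    have heq' : (h₁ : ZMod p) = (h₂ : ZMod p) := heq
    rw [← e1, ← e2, heq']
  -- (d) the shift bound for `ψ'`
  have hψ'shift : ∀ x, ∀ h₁ ∈ H', ∀ h₂ ∈ H', |ψ' (x + h₁ + h₂) - ψ' x| ≤ κ' x := by
    intro x h₁' hh₁' h₂' hh₂'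
    obtain ⟨h₁, hh₁, rfl⟩ := hmemH' h₁' hh₁'
    obtain ⟨h₂, hh₂, rfl⟩ := hmemH' h₂' hh₂'
    have hhabs : |h₁ + h₂| ≤ 2 * N := by
      have := (hH h₁ hh₁).1; have := (hH h₂ hh₂).1
      have := abs_add_le h₁ h₂; linarith
    have hqh : (q : ℤ) ∣ h₁ + h₂ := dvd_add (hH h₁ hh₁).2 (hH h₂ hh₂).2
    have exh : x + (h₁ : ZMod p) + (h₂ : ZMod p) = x + ((h₁ + h₂ : ℤ) : ZMod p) := by push_cast; ring
    rw [exh]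
    simp only [hκ']
    by_cases hwrap : (x + ((h₁ + h₂ : ℤ) : ZMod p)).valMinAbs = x.valMinAbs + (h₁ + h₂)
    · -- no wrap-around
      simp only [hψ']
      rw [hwrap]
      by_cases hcl : (q : ℤ) ∣ x.valMinAbs - r
      · have hcl2 : (q : ℤ) ∣ x.valMinAbs + (h₁ + h₂) - r := by
          have : x.valMinAbs + (h₁ + h₂) - r = (x.valMinAbs - r) + (h₁ + h₂) := by ring
          rw [this]; exact dvd_add hcl hqh
        rw [if_pos hcl2, if_pos hcl, ← add_assoc]
        exact hw _ h₁ hh₁ h₂ hh₂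
      · have hcl2 : ¬ (q : ℤ) ∣ x.valMinAbs + (h₁ + h₂) - r := by
          intro h
          apply hcl
          have : x.valMinAbs - r = (x.valMinAbs + (h₁ + h₂) - r) - (h₁ + h₂) := by ring
          rw [this]; exact dvd_sub h hqh
        rw [if_neg hcl2, if_neg hcl, sub_zero, abs_zero]
        exact hw0 _
    · -- wrap-around: both values of `ψ` vanish
      obtain ⟨hfar1, hfar2⟩ := le_of_valMinAbs_add_ne x (h₁ + h₂) hwrap
      have hz1 : ψ (ZMod.valMinAbs x) = 0 := by
        by_contra hne1
        have h12 := hsupp _ hne1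
        have : |ZMod.valMinAbs x| ≤ 2 * N := abs_le.2 ⟨by linarith [h12.1], h12.2⟩
        linarith
      have hz2 : ψ (ZMod.valMinAbs (x + ((h₁ + h₂ : ℤ) : ZMod p))) = 0 := by
        by_contra hne2
        have h12 := hsupp _ hne2
        have : |ZMod.valMinAbs (x + ((h₁ + h₂ : ℤ) : ZMod p))| ≤ 2 * N :=
          abs_le.2 ⟨by linarith [h12.1], h12.2⟩
        linarith
      have e1 : ψ' x = 0 := by simp only [hψ', hz1, ite_self]
      have e2 : ψ' (x + ((h₁ + h₂ : ℤ) : ZMod p)) = 0 := by simp only [hψ', hz2, ite_self]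
      rw [e1, e2, sub_zero, abs_zero]
      exact hw0 _
  -- (e) the three-term bound for `φ'`
  have hφ'lin : ∀ x, ψ' x ≠ 0 → ∀ h₁ ∈ H', ∀ h₂ ∈ H',
      ‖φ' x - φ' (x + h₁ + h₂) + φ' (nₛ + h₁) + φ' (nₛ + h₂) - 2 • φ' nₛ‖ ≤ ε := by
    intro x hx h₁' hh₁' h₂' hh₂'
    obtain ⟨h₁, hh₁, rfl⟩ := hmemH' h₁' hh₁'
    obtain ⟨h₂, hh₂, rfl⟩ := hmemH' h₂' hh₂'
    have hcl : (q : ℤ) ∣ ZMod.valMinAbs x - r := by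
      by_contra h; apply hx; simp only [hψ']; rw [if_neg h]
    have hψn : ψ (ZMod.valMinAbs x) ≠ 0 := by
      intro h; apply hx; simp only [hψ']; rw [if_pos hcl, h]
    set n : ℤ := ZMod.valMinAbs x with hn
    have hnN := hsupp n hψn
    have hnsN : (N : ℤ) < (ns : ℤ) ∧ (ns : ℤ) ≤ 2 * N := ⟨by exact_mod_cast hns1, by exact_mod_cast hns2⟩
    have ex : x = ((n : ℤ) : ZMod p) := (hιx x).symm
    have l1 : ZMod.valMinAbs (x + (h₁ : ZMod p) + (h₂ : ZMod p)) = n + h₁ + h₂ := by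
      rw [ex]
      have e : ((n : ℤ) : ZMod p) + (h₁ : ZMod p) + (h₂ : ZMod p) = ((n + h₁ + h₂ : ℤ) : ZMod p) := by
        push_cast; ring
      rw [e]; exact hιint _ (hshift n hnN h₁ hh₁ h₂ hh₂)
    have l2 : ∀ h ∈ H, ZMod.valMinAbs (nₛ + (h : ZMod p)) = ns + h := by
      intro h hh
      rw [hnₛ]
      have e : ((ns : ℤ) : ZMod p) + (h : ZMod p) = (((ns : ℤ) + h + 0 : ℤ) : ZMod p) := by
        push_cast; ring
      rw [e, hιint _ (hshift _ hnsN h hh 0 h0H)]; ring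
    have hqd : (q : ℤ) ∣ n - ns := by
      have h2 := hdvd_of_mod ns hnsr
      have : n - ns = (n - r) - ((ns : ℤ) - r) := by ring
      rw [this]; exact dvd_sub hcl h2
    simp only [hφ']
    rw [l1, l2 h₁ hh₁, l2 h₂ hh₂, hιns]
    exact h3 n ns hψn hψns hqd h₁ hh₁ h₂ hh₂
  -- (f) the pointwise approximate duality `happrox`
  have happrox : ∀ x, ∀ h₁ ∈ H', ∀ h₂ ∈ H',
      ‖a x * f x - c * (a x * F h₁ * F h₂ * f (x + h₁ + h₂))‖ ≤ w' x := by
    intro x h₁ hh₁ h₂ hh₂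
    have step := norm_weight_phase_sub_le φ' ψ' κ' a H' nₛ hψ'0 hφ'lin hψ'shift x hh₁ hh₂
    refine step.trans ?_
    -- fibre analysis: every `n` in the fibre of `x` equals `ZMod.valMinAbs x`
    set Fx := Sr.filter (fun n : ℕ => ((n : ℕ) : ZMod p) = x) with hFx
    have hfib : ∀ n ∈ Fx, ZMod.valMinAbs x = n ∧ n % q = r := by
      intro n hn
      rw [hFx, mem_filter] at hn
      obtain ⟨hnSr, hnx⟩ := hn
      obtain ⟨_, hn2, hn3⟩ := hmemSr n hnSr
      exact ⟨by rw [← hnx]; exact hιnat n hn2, hn3⟩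
    have hval : ∀ n ∈ Fx, 2 * Real.pi * ε * ψ' x + κ' x = 2 * Real.pi * ε * ψ n + w n := by
      intro n hn
      obtain ⟨h1, h2⟩ := hfib n hn
      simp only [hψ', hκ']
      rw [h1, if_pos (hdvd_of_mod n h2)]
    have hnn : 0 ≤ 2 * Real.pi * ε * ψ' x + κ' x := by
      have := hψ'0 x; have := hw0 (ZMod.valMinAbs x); simp only [hκ']; positivity
    have ha_le : ‖a x‖ ≤ ∑ n ∈ Fx, (1 : ℝ) := by
      simp only [ha]
      refine (norm_sum_le _ _).trans (Finset.sum_le_sum fun n _ => ?_)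
      rw [Complex.norm_real, Real.norm_eq_abs]
      exact_mod_cast abs_moebius_le_one
    calc ‖a x‖ * (2 * Real.pi * ε * ψ' x + κ' x)
        ≤ (∑ n ∈ Fx, (1 : ℝ)) * (2 * Real.pi * ε * ψ' x + κ' x) :=
          mul_le_mul_of_nonneg_right ha_le hnn
      _ = ∑ n ∈ Fx, (2 * Real.pi * ε * ψ' x + κ' x) := by
          rw [Finset.sum_const, Finset.sum_const, nsmul_eq_mul, nsmul_eq_mul, mul_one]
      _ = ∑ n ∈ Fx, (2 * Real.pi * ε * ψ n + w n) := Finset.sum_congr rfl hval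
      _ = w' x := by simp only [hw', hFx]
  have main := norm_sum_le_of_approx_dual H' hH'ne a f F c w' hfle hFle hD0 hDa happrox
  -- (h) read the conclusion back in `ℤ`
  have eL : ∑ x : ZMod p, a x * f x =
      ∑ n ∈ Sr, ((μ n : ℝ) : ℂ) * ((ψ n : ℝ) : ℂ) * ((AddCircle.toCircle (-φ n) : Circle) : ℂ) := by
    simp only [ha]
    rw [sum_fiber_eq_sum Sr (fun n => ((μ n : ℝ) : ℂ)) f]
    refine Finset.sum_congr rfl fun n hn => ?_
    obtain ⟨_, hn2, hn3⟩ := hmemSr n hn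
    simp only [hf, hψ', hφ']
    rw [hιnat n hn2, if_pos (hdvd_of_mod n hn3)]
    ring
  have eW : ∑ x : ZMod p, w' x = ∑ n ∈ Sr, (2 * Real.pi * ε * ψ n + w n) := by
    simp only [hw']
    exact sum_fiber_eq_sum_real Sr _
  have hcn : ‖c‖ = 1 := by simp only [hc]; exact Circle.norm_coe _
  rw [eL, eW, hcn, one_mul, hcardH'] at main
  exact main

end Summit.Parity.GeneralizedHardyLittlewood.GreenTaoLevelTwoMNTwoAlmostLinearThreeTerm
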